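import Mathlib
import Summits.Ventures.PercRepro2.Defs
import Summits.Ventures.PercRepro2.Independence
import Summits.Ventures.PercRepro2.Harris
import Summits.Ventures.PercRepro2.Graph
import Summits.Ventures.PercRepro2.Exploration
import Summits.Ventures.PercRepro2.Events
import Summits.Ventures.PercRepro2.R2PrimeThreeReduction

/-!
# (Y) and its bridge to SC″ (blind cell PercRepro2, typer-1; `proofs/LEAD-PROOFSHAPES.md` §8.9 ADDENDUM 10)

Three-root notation: roots `o, b, a₁, a₂, a₃`; `C_i = C(a_i)`; `Ũ = C₁ ∪ C₂` (`UnionCluster.inU`);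
`D̃ = {a₃ ∉ Ũ}`; `PD = {C₁ ≠ C₂, a₃ ∉ Ũ}`; `T = {a₁ ∉ C₂, a₃ ∈ C₂}`; and the masses

* `φ = P(o ∈ Ũ | D̃)` (the SC″ constant `c′`), `M₂ = P(PD, b ∈ C₂)`,
  `Δ_T = P(b ∈ C₂, T) − P(b ∈ C₁, T)`, `split = P(PD, o ∈ C₁, b ∈ C₂) + P(PD, o ∈ C₂, b ∈ C₁)`,
  `mb = P(b ∈ Ũ, D̃)`, `m₃ = P(b ↔ a₃, D̃)`, `B_i = P(b ∈ C_i, D̃)`, `m₁₂ = P(b ∈ C₁ ∩ C₂, D̃)`.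

* **(Y)** (row 2′Y): `split ≤ φ · (M₂ + Δ_T)` under the labelling `P(b ↔ a₁) ≤ P(b ↔ a₂)`
  (`a₁` = light, `a₂` = heavy, `a₃` a free root);
* `gap_decomp`: `P(b ↔ a₃) − P(b ↔ a₁) = (m₃ − B₁) + Δ_T` (indicator case split on where `a₃`
  sits: `∉ Ũ` / `∈ C₁ = C₂` / `∈ C₁ ≠ C₂` / `∈ C₂ ≠ C₁`);
* `Y_slack_eq`: `φ (M₂ + Δ_T) − split = (φ (mb − m₃) − split) + φ (P(b ↔ a₃) − P(b ↔ a₁))`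
  (with the mass identities `mb = B₁ + B₂ − m₁₂`, `M₂ = B₂ − m₁₂`);
* `SC2_of_Y`: `(Y)` and `P(b ↔ a₃) ≤ P(b ↔ a₁)` give **SC″ at `a₃`**: `split ≤ φ (mb − m₃)`.

So `SC′ ⇐ SC″ ⇐ (Y) + order`, one level below `UnionCluster.r2prime3_of_quant_of_SC`.
-/

namespace Summit.Ventures.PercRepro2

open UnionCluster

section YDefs

variable {V : Type*} {E : Type*} [Fintype E] [DecidableEq E] {R : Type*} [Field R]
  [LinearOrder R]

/-- `D̃ = {a₃ ∉ Ũ}`, `Ũ = C₁ ∪ C₂`. -/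
def Dtilde (ends : E → Sym2 V) (a₁ a₂ a₃ : V) : Set (Config E) := (inU ends a₁ a₂ a₃)ᶜ

/-- `PD = {C₁ ≠ C₂, a₃ ∉ Ũ}`. -/
def PDEvent (ends : E → Sym2 V) (a₁ a₂ a₃ : V) : Set (Config E) :=
  (connEvent ends a₁ a₂)ᶜ ∩ Dtilde ends a₁ a₂ a₃

/-- `T = {a₁ ∉ C₂, a₃ ∈ C₂}`. -/
def TEvent (ends : E → Sym2 V) (a₁ a₂ a₃ : V) : Set (Config E) :=
  (connEvent ends a₂ a₁)ᶜ ∩ connEvent ends a₂ a₃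

/-- `φ = P(o ∈ Ũ | D̃)`. -/
noncomputable def phi (p : E → R) (ends : E → Sym2 V) (o a₁ a₂ a₃ : V) : R :=
  prob p (inU ends a₁ a₂ o ∩ Dtilde ends a₁ a₂ a₃) / prob p (Dtilde ends a₁ a₂ a₃)

/-- `M₂ = P(PD, b ∈ C₂)`. -/
noncomputable def massM2 (p : E → R) (ends : E → Sym2 V) (a₁ a₂ a₃ b : V) : R :=
  prob p (PDEvent ends a₁ a₂ a₃ ∩ connEvent ends a₂ b)

/-- `Δ_T = P(b ∈ C₂, T) − P(b ∈ C₁, T)`. -/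
noncomputable def deltaT (p : E → R) (ends : E → Sym2 V) (a₁ a₂ a₃ b : V) : R :=
  prob p (connEvent ends a₂ b ∩ TEvent ends a₁ a₂ a₃) -
    prob p (connEvent ends a₁ b ∩ TEvent ends a₁ a₂ a₃)

/-- `split = P(PD, o ∈ C₁, b ∈ C₂) + P(PD, o ∈ C₂, b ∈ C₁)`. -/
noncomputable def splitMass (p : E → R) (ends : E → Sym2 V) (o a₁ a₂ a₃ b : V) : R :=
  prob p (PDEvent ends a₁ a₂ a₃ ∩ connEvent ends a₁ o ∩ connEvent ends a₂ b) +
    prob p (PDEvent ends a₁ a₂ a₃ ∩ connEvent ends a₂ o ∩ connEvent ends a₁ b)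

/-- `mb = P(b ∈ Ũ, D̃)`. -/
noncomputable def massB (p : E → R) (ends : E → Sym2 V) (a₁ a₂ a₃ b : V) : R :=
  prob p (inU ends a₁ a₂ b ∩ Dtilde ends a₁ a₂ a₃)

/-- `m₃ = P(b ↔ a₃, D̃)`. -/
noncomputable def massM3 (p : E → R) (ends : E → Sym2 V) (a₁ a₂ a₃ b : V) : R :=
  prob p (connEvent ends a₃ b ∩ Dtilde ends a₁ a₂ a₃)

/-- `B₁ = P(b ∈ C₁, D̃)`. -/
noncomputable def massB1 (p : E → R) (ends : E → Sym2 V) (a₁ a₂ a₃ b : V) : R :=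
  prob p (connEvent ends a₁ b ∩ Dtilde ends a₁ a₂ a₃)

/-- `B₂ = P(b ∈ C₂, D̃)`. -/
noncomputable def massB2 (p : E → R) (ends : E → Sym2 V) (a₁ a₂ a₃ b : V) : R :=
  prob p (connEvent ends a₂ b ∩ Dtilde ends a₁ a₂ a₃)

/-- `m₁₂ = P(b ∈ C₁ ∩ C₂, D̃)`. -/
noncomputable def massM12 (p : E → R) (ends : E → Sym2 V) (a₁ a₂ a₃ b : V) : R :=
  prob p (connEvent ends a₁ b ∩ connEvent ends a₂ b ∩ Dtilde ends a₁ a₂ a₃)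

/-- **(Y)** (row 2′Y): `split ≤ φ · (M₂ + Δ_T)`; the labelling `P(b ↔ a₁) ≤ P(b ↔ a₂)` is a
separate hypothesis in the closures below (`a₁` light, `a₂` heavy, `a₃` any third root). -/
def Y (p : E → R) (ends : E → Sym2 V) (o a₁ a₂ a₃ b : V) : Prop :=
  splitMass p ends o a₁ a₂ a₃ b ≤
    phi p ends o a₁ a₂ a₃ * (massM2 p ends a₁ a₂ a₃ b + deltaT p ends a₁ a₂ a₃ b)

/-- **SC″ at `a₃`** (ratio form, §8.9 ADDENDUM 6): `split ≤ φ · (mb − m₃)`. -/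
def SC2 (p : E → R) (ends : E → Sym2 V) (o a₁ a₂ a₃ b : V) : Prop :=
  splitMass p ends o a₁ a₂ a₃ b ≤
    phi p ends o a₁ a₂ a₃ * (massB p ends a₁ a₂ a₃ b - massM3 p ends a₁ a₂ a₃ b)

end YDefs

section Bookkeeping

variable {V : Type*} {E : Type*} [Fintype E] [DecidableEq E] {R : Type*} [Field R]
  [LinearOrder R] [IsStrictOrderedRing R]

omit [Fintype E] [DecidableEq E] [Field R] [LinearOrder R] [IsStrictOrderedRing R] in
/-- `D̃ = {a₃ ↮ a₁} ∩ {a₃ ↮ a₂}`. -/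
lemma Dtilde_eq (ends : E → Sym2 V) (a₁ a₂ a₃ : V) :
    Dtilde ends a₁ a₂ a₃ = (connEvent ends a₃ a₁)ᶜ ∩ (connEvent ends a₃ a₂)ᶜ := by
  ext ω
  simp [Dtilde, inU]

omit [Fintype E] [DecidableEq E] [Field R] [LinearOrder R] [IsStrictOrderedRing R] in
/-- On `{x ↔ y}`, `{y ↔ b}` is `{x ↔ b}` (with a further factor `A`). -/
lemma connEvent_inter_connEvent_eq' (ends : E → Sym2 V) (x y b : V) (A : Set (Config E)) :
    connEvent ends y b ∩ A ∩ connEvent ends x y = connEvent ends x b ∩ A ∩ connEvent ends x y := by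
  ext ω
  simp only [Set.mem_inter_iff, mem_connEvent]
  exact ⟨fun ⟨⟨h1, h2⟩, h3⟩ => ⟨⟨conn_trans h3 h1, h2⟩, h3⟩,
    fun ⟨⟨h1, h2⟩, h3⟩ => ⟨⟨conn_trans (conn_symm h3) h1, h2⟩, h3⟩⟩

omit [Fintype E] [DecidableEq E] [Field R] [LinearOrder R] [IsStrictOrderedRing R] in
/-- `{a₃ ∉ C₁, a₃ ∈ C₂} = T`. -/
lemma compl_inter_conn_eq_TEvent (ends : E → Sym2 V) (a₁ a₂ a₃ : V) :
    (connEvent ends a₃ a₁)ᶜ ∩ connEvent ends a₃ a₂ = TEvent ends a₁ a₂ a₃ := by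
  ext ω
  simp only [TEvent, Set.mem_inter_iff, Set.mem_compl_iff, mem_connEvent]
  constructor
  · rintro ⟨h1, h2⟩
    exact ⟨fun h => h1 (conn_trans h2 h), conn_symm h2⟩
  · rintro ⟨h1, h2⟩
    exact ⟨fun h => h1 (conn_trans h2 h), conn_symm h2⟩

/-- A probability split along the two events `{a₃ ∈ C₁}`, `{a₃ ∈ C₂}`. -/
lemma prob_split_four (p : E → R) (ends : E → Sym2 V) (a₁ a₂ a₃ : V) (X : Set (Config E)) :
    prob p X =
      prob p (X ∩ connEvent ends a₃ a₁ ∩ connEvent ends a₃ a₂) +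
        prob p (X ∩ connEvent ends a₃ a₁ ∩ (connEvent ends a₃ a₂)ᶜ) +
        prob p (X ∩ (connEvent ends a₃ a₁)ᶜ ∩ connEvent ends a₃ a₂) +
        prob p (X ∩ (connEvent ends a₃ a₁)ᶜ ∩ (connEvent ends a₃ a₂)ᶜ) := by
  have h1 := prob_inter_add_prob_inter_compl p X (connEvent ends a₃ a₁)
  have h2 := prob_inter_add_prob_inter_compl p (X ∩ connEvent ends a₃ a₁) (connEvent ends a₃ a₂)
  have h3 := prob_inter_add_prob_inter_compl p (X ∩ (connEvent ends a₃ a₁)ᶜ)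
    (connEvent ends a₃ a₂)
  linarith

/-- **`gap_decomp`**: `P(b ↔ a₃) − P(b ↔ a₁) = (m₃ − B₁) + Δ_T`. -/
theorem gap_decomp (p : E → R) (ends : E → Sym2 V) (a₁ a₂ a₃ b : V) :
    prob p (connEvent ends a₃ b) - prob p (connEvent ends a₁ b) =
      (massM3 p ends a₁ a₂ a₃ b - massB1 p ends a₁ a₂ a₃ b) + deltaT p ends a₁ a₂ a₃ b := by
  have e3 := prob_split_four p ends a₁ a₂ a₃ (connEvent ends a₃ b)
  have e1 := prob_split_four p ends a₁ a₂ a₃ (connEvent ends a₁ b)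
  -- on `{a₃ ∈ C₁}`, `b ↔ a₃` is `b ↔ a₁`; on `{a₃ ∈ C₂}`, it is `b ↔ a₂`
  have s1 : ∀ A : Set (Config E), connEvent ends a₃ b ∩ connEvent ends a₃ a₁ ∩ A =
      connEvent ends a₁ b ∩ connEvent ends a₃ a₁ ∩ A := by
    intro A
    ext ω
    simp only [Set.mem_inter_iff, mem_connEvent]
    exact ⟨fun ⟨⟨h1, h2⟩, h3⟩ => ⟨⟨conn_trans (conn_symm h2) h1, h2⟩, h3⟩,
      fun ⟨⟨h1, h2⟩, h3⟩ => ⟨⟨conn_trans h2 h1, h2⟩, h3⟩⟩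
  have s2 : connEvent ends a₃ b ∩ (connEvent ends a₃ a₁)ᶜ ∩ connEvent ends a₃ a₂ =
      connEvent ends a₂ b ∩ (connEvent ends a₃ a₁)ᶜ ∩ connEvent ends a₃ a₂ := by
    ext ω
    simp only [Set.mem_inter_iff, mem_connEvent]
    exact ⟨fun ⟨⟨h1, h2⟩, h3⟩ => ⟨⟨conn_trans (conn_symm h3) h1, h2⟩, h3⟩,
      fun ⟨⟨h1, h2⟩, h3⟩ => ⟨⟨conn_trans h3 h1, h2⟩, h3⟩⟩
  have c1 : prob p (connEvent ends a₃ b ∩ connEvent ends a₃ a₁ ∩ connEvent ends a₃ a₂) =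
      prob p (connEvent ends a₁ b ∩ connEvent ends a₃ a₁ ∩ connEvent ends a₃ a₂) := by rw [s1]
  have c2 : prob p (connEvent ends a₃ b ∩ connEvent ends a₃ a₁ ∩ (connEvent ends a₃ a₂)ᶜ) =
      prob p (connEvent ends a₁ b ∩ connEvent ends a₃ a₁ ∩ (connEvent ends a₃ a₂)ᶜ) := by rw [s1]
  have c3 : prob p (connEvent ends a₃ b ∩ (connEvent ends a₃ a₁)ᶜ ∩ connEvent ends a₃ a₂) =
      prob p (connEvent ends a₂ b ∩ TEvent ends a₁ a₂ a₃) := by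
    rw [s2, Set.inter_assoc, compl_inter_conn_eq_TEvent]
  have c3' : prob p (connEvent ends a₁ b ∩ (connEvent ends a₃ a₁)ᶜ ∩ connEvent ends a₃ a₂) =
      prob p (connEvent ends a₁ b ∩ TEvent ends a₁ a₂ a₃) := by
    rw [Set.inter_assoc, compl_inter_conn_eq_TEvent]
  have d3 : prob p (connEvent ends a₃ b ∩ (connEvent ends a₃ a₁)ᶜ ∩ (connEvent ends a₃ a₂)ᶜ) =
      massM3 p ends a₁ a₂ a₃ b := by
    unfold massM3
    rw [Set.inter_assoc, ← Dtilde_eq]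
  have d1 : prob p (connEvent ends a₁ b ∩ (connEvent ends a₃ a₁)ᶜ ∩ (connEvent ends a₃ a₂)ᶜ) =
      massB1 p ends a₁ a₂ a₃ b := by
    unfold massB1
    rw [Set.inter_assoc, ← Dtilde_eq]
  unfold deltaT
  linarith

/-- `mb = B₁ + B₂ − m₁₂` (inclusion–exclusion on `b ∈ Ũ = C₁ ∪ C₂`). -/
lemma massB_eq (p : E → R) (ends : E → Sym2 V) (a₁ a₂ a₃ b : V) :
    massB p ends a₁ a₂ a₃ b =
      massB1 p ends a₁ a₂ a₃ b + massB2 p ends a₁ a₂ a₃ b - massM12 p ends a₁ a₂ a₃ b := by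
  unfold massB massB1 massB2 massM12
  have e : inU ends a₁ a₂ b ∩ Dtilde ends a₁ a₂ a₃ =
      (connEvent ends a₁ b ∩ Dtilde ends a₁ a₂ a₃) ∪
        (connEvent ends a₂ b ∩ Dtilde ends a₁ a₂ a₃) := by
    rw [inU, connEvent_comm ends b a₁, connEvent_comm ends b a₂, Set.union_inter_distrib_right]
  have h := prob_union_add_prob_inter p (connEvent ends a₁ b ∩ Dtilde ends a₁ a₂ a₃)
    (connEvent ends a₂ b ∩ Dtilde ends a₁ a₂ a₃)
  have e2 : connEvent ends a₁ b ∩ Dtilde ends a₁ a₂ a₃ ∩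
      (connEvent ends a₂ b ∩ Dtilde ends a₁ a₂ a₃) =
      connEvent ends a₁ b ∩ connEvent ends a₂ b ∩ Dtilde ends a₁ a₂ a₃ := by
    ext ω; simp only [Set.mem_inter_iff]; tauto
  rw [e2] at h
  rw [e]
  linarith

/-- `M₂ = B₂ − m₁₂` (on `{a₁ ↔ a₂}`, `b ∈ C₂` is `b ∈ C₁ ∩ C₂`). -/
lemma massM2_eq (p : E → R) (ends : E → Sym2 V) (a₁ a₂ a₃ b : V) :
    massM2 p ends a₁ a₂ a₃ b = massB2 p ends a₁ a₂ a₃ b - massM12 p ends a₁ a₂ a₃ b := by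
  unfold massM2 massB2 massM12 PDEvent
  have h := prob_inter_add_prob_inter_compl p (connEvent ends a₂ b ∩ Dtilde ends a₁ a₂ a₃)
    (connEvent ends a₁ a₂)
  have e1 : connEvent ends a₂ b ∩ Dtilde ends a₁ a₂ a₃ ∩ connEvent ends a₁ a₂ =
      connEvent ends a₁ b ∩ connEvent ends a₂ b ∩ Dtilde ends a₁ a₂ a₃ := by
    ext ω
    simp only [Set.mem_inter_iff, mem_connEvent]
    constructor
    · rintro ⟨⟨h1, h2⟩, h3⟩
      exact ⟨⟨conn_trans h3 h1, h1⟩, h2⟩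
    · rintro ⟨⟨h1, h2⟩, h3⟩
      exact ⟨⟨h2, h3⟩, conn_trans h1 (conn_symm h2)⟩
  have e2 : (connEvent ends a₁ a₂)ᶜ ∩ Dtilde ends a₁ a₂ a₃ ∩ connEvent ends a₂ b =
      connEvent ends a₂ b ∩ Dtilde ends a₁ a₂ a₃ ∩ (connEvent ends a₁ a₂)ᶜ := by
    ext ω; simp only [Set.mem_inter_iff]; tauto
  rw [e1] at h
  rw [e2]
  linarith

/-- **`Y_slack_eq`**:
`φ (M₂ + Δ_T) − split = (φ (mb − m₃) − split) + φ (P(b ↔ a₃) − P(b ↔ a₁))`. -/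
theorem Y_slack_eq (p : E → R) (ends : E → Sym2 V) (o a₁ a₂ a₃ b : V) :
    phi p ends o a₁ a₂ a₃ * (massM2 p ends a₁ a₂ a₃ b + deltaT p ends a₁ a₂ a₃ b) -
        splitMass p ends o a₁ a₂ a₃ b =
      (phi p ends o a₁ a₂ a₃ * (massB p ends a₁ a₂ a₃ b - massM3 p ends a₁ a₂ a₃ b) -
          splitMass p ends o a₁ a₂ a₃ b) +
        phi p ends o a₁ a₂ a₃ *
          (prob p (connEvent ends a₃ b) - prob p (connEvent ends a₁ b)) := by
  rw [gap_decomp p ends a₁ a₂ a₃ b, massB_eq p ends a₁ a₂ a₃ b, massM2_eq p ends a₁ a₂ a₃ b]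
  ring

/-- `φ ≥ 0` for admissible weights. -/
lemma phi_nonneg {p : E → R} (hp : IsProbVec p) (ends : E → Sym2 V) (o a₁ a₂ a₃ : V) :
    0 ≤ phi p ends o a₁ a₂ a₃ :=
  div_nonneg (prob_nonneg hp _) (prob_nonneg hp _)

/-- **`SC2_of_Y`**: (Y) and the order `P(b ↔ a₃) ≤ P(b ↔ a₁)` give SC″ at `a₃`. -/
theorem SC2_of_Y {p : E → R} (hp : IsProbVec p) (ends : E → Sym2 V) {o a₁ a₂ a₃ b : V}
    (hY : Y p ends o a₁ a₂ a₃ b)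
    (h3 : prob p (connEvent ends a₃ b) ≤ prob p (connEvent ends a₁ b)) :
    SC2 p ends o a₁ a₂ a₃ b := by
  unfold Y at hY
  unfold SC2
  have e := Y_slack_eq p ends o a₁ a₂ a₃ b
  have hφ := phi_nonneg hp ends o a₁ a₂ a₃
  have : phi p ends o a₁ a₂ a₃ * (prob p (connEvent ends a₃ b) - prob p (connEvent ends a₁ b)) ≤ 0 :=
    mul_nonpos_of_nonneg_of_nonpos hφ (by linarith)
  linarith

end Bookkeeping

section Closures

variable (R : Type) [Field R] [LinearOrder R] [IsStrictOrderedRing R]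

/-- **(Y) for every finite graph**: distinct roots `o, b, a₁, a₂, a₃`, labelling
`P(b ↔ a₁) ≤ P(b ↔ a₂)` (`a₁` light, `a₂` heavy), `a₃` any third root. -/
def Y_all : Prop :=
  ∀ (V E : Type) [Fintype V] [DecidableEq V] [Fintype E] [DecidableEq E]
    (ends : E → Sym2 V) (p : E → R), IsProbVec p →
    ∀ o a₁ a₂ a₃ b : V, a₁ ≠ a₂ → a₁ ≠ a₃ → a₂ ≠ a₃ → o ≠ a₁ → o ≠ a₂ → o ≠ a₃ → o ≠ b →
      b ≠ a₁ → b ≠ a₂ → b ≠ a₃ →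
      prob p (connEvent ends a₁ b) ≤ prob p (connEvent ends a₂ b) → Y p ends o a₁ a₂ a₃ b

/-- **SC″ for every finite graph**, at the minimiser `a₃` (`P(b ↔ a₃) ≤ P(b ↔ a₁) ≤ P(b ↔ a₂)`). -/
def SC2_all : Prop :=
  ∀ (V E : Type) [Fintype V] [DecidableEq V] [Fintype E] [DecidableEq E]
    (ends : E → Sym2 V) (p : E → R), IsProbVec p →
    ∀ o a₁ a₂ a₃ b : V, a₁ ≠ a₂ → a₁ ≠ a₃ → a₂ ≠ a₃ → o ≠ a₁ → o ≠ a₂ → o ≠ a₃ → o ≠ b →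
      b ≠ a₁ → b ≠ a₂ → b ≠ a₃ →
      prob p (connEvent ends a₃ b) ≤ prob p (connEvent ends a₁ b) →
      prob p (connEvent ends a₁ b) ≤ prob p (connEvent ends a₂ b) → SC2 p ends o a₁ a₂ a₃ b

/-- `(Y)` for all graphs gives SC″ for all graphs. -/
theorem SC2_all_of_Y_all (h : Y_all R) : SC2_all R := by
  intro V E _ _ _ _ ends p hp o a₁ a₂ a₃ b h12 h13 h23 ho1 ho2 ho3 hob hb1 hb2 hb3 h31 h12'
  exact SC2_of_Y hp ends (h V E ends p hp o a₁ a₂ a₃ b h12 h13 h23 ho1 ho2 ho3 hob hb1 hb2 hb3 h12')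
    h31

end Closures

end Summit.Ventures.PercRepro2
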